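import Literature.MathematicalPhysics.QuantumLattice.InfVolFermionStateBounds
import Literature.MathematicalPhysics.QuantumLattice.HubbardTTPrimeEnergyDensityVariationalPrinciple
import Literature.MathematicalPhysics.QuantumLattice.FermionEmbedLocality
import Literature.MathematicalPhysics.QuantumLattice.HubbardJordanWignerLocality
import HarnessLib

/-!
# Ground states of lattice fermion systems minimise the local energy and the mean energy
# (Bratteli–Kishimoto–Robinson 1978, Theorems 1–2, direction "ground state ⇒ minimiser"),
# for the `t–t'` Hubbard model on `ℤ²` with a chemical potential

Topic `Literature/MathematicalPhysics/QuantumLattice`; namespace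
`Literature.MathematicalPhysics.QuantumLattice` (the file path). Vocabulary of `InfVolFermionState.lean`
§6 (`FermionInteraction.localHamiltonian`, `FermionInteraction.derivation`,
`InfVolFermionState.IsGroundState` = the LOCAL Bratteli–Robinson ground-state condition
`-i ω(A⋆ δ(A)) ≥ 0`, `InfVolFermionState.meanEnergy`), of
`HubbardTTPrimeEnergyDensityVariationalPrinciple.lean` (`energyDensityTT'` is the least `t–t'` mean
energy of a translation-invariant state of prescribed density) and of
`InfVolFermionStateTTPrimeMeanEnergyBox.lean` (mean energy versus box Hamiltonians).

## What is proved (no definition, no named fact)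

* §1 **Local stability summed over a Kraus family** (pure operator algebra, any dimension `d`,
  regions `Λ ⊆ Λ'`, any `H ∈ 𝔄_{Λ'}`). If a state `ω` is *locally `H`-stable on `Λ`*, i.e.
  `Re ω((Γ A)⋆ [H, Γ A]) ≥ 0` for every `A ∈ 𝔄_Λ` (`Γ = fermionEmbed (incl Λ ⊆ Λ')`), then for
  every finite family `A_k ∈ 𝔄_Λ` with `Σ_k A_k⋆ A_k = 1`: `Re ω(H) ≤ Re ω(Σ_k (Γ A_k)⋆ H (Γ A_k))`
  (`re_expect_le_re_expect_sum_conj_of_localStability`). For the Kraus family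
  `A_{(s,t)} = √ρ_Λ^σ · e_{ts}` of the density matrix `ρ_Λ^σ` of ANOTHER state `σ`
  (`√` = `CFC.sqrt`): `Σ A⋆ A = 1` and `Σ A⋆ Z A = σ_Λ(Z) · 1` (`sum_conj_krausOfState`), the map
  `Z ↦ ω(Σ (Γ A)⋆ Z (Γ A))` is contractive (`norm_expect_sum_conj_le`: a unital positive functional,
  Bratteli–Robinson I Prop. 2.3.11), and it fixes every `Z` commuting with `Γ 𝔄_Λ`
  (`sum_conj_eq_self_of_commute`). Consequence (`re_expect_le_of_localStability_of_decomp`): if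
  `H = Γ(H_in) + H_far + H_×` with `H_far` commuting with `Γ 𝔄_Λ`, then
  `Re ω_Λ(H_in) ≤ Re σ_Λ(H_in) + 2 ‖H_×‖` for EVERY state `σ` — Bratteli–Kishimoto–Robinson's
  *principle of minimum local energy* (their Theorem 1, `2 ⇒ 1`) in the product-state case
  `ω' = σ_Λ ⊗ ω_{Λᶜ}` that their Theorem 2 uses, with the surface energy `W_Φ(Λ)` bounded by
  `2‖H_×‖`.
* §1 also: **local stability ⇒ stationarity** `ω([H, Γ B]) = 0` for every `B ∈ 𝔄_Λ`
  (`expect_commutator_eq_zero_of_localStability`; Bratteli–Robinson II Prop. 5.3.19, the step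
  "replace `A` by `A + λ𝟙`"; Naaijkens 2017 §4.1, the lemma following the definition of ground
  states, arXiv text pp. 36–37).
* §2 **Interactions**: `IsGroundState ω Ψ R` is local `H^Ψ_{thicken Λ R}`-stability on every `Λ`
  (`IsGroundState.re_expect_conj_commutator_nonneg`); for an EVEN interaction the local Hamiltonian of
  `Λ' ⊇ Λ` splits as `Γ(H^Ψ_Λ) + (terms disjoint from Λ) + (terms crossing ∂Λ)` with the middle part
  commuting with `Γ 𝔄_Λ` (graded locality, `FermionEmbedLocality.lean`); hence
  **BKR Theorem 1 (product case) for every even finite-range interaction**: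
  `Re ω_Λ(H^Ψ_Λ) ≤ Re σ_Λ(H^Ψ_Λ) + 2 ‖Σ_{X ⊆ thicken Λ R crossing ∂Λ} Φ X‖`
  (`IsGroundState.re_expect_localHamiltonian_le`).
* §3 **The `t–t'` Hubbard model on `ℤ²` with chemical potential `μ`.** Hypothesis (a section
  variable `hgs`): `ω` is locally `(H^{tt'}_{thicken Λ 1} - μ N_{thicken Λ 1})`-stable on every finite
  `Λ ⊆ ℤ²` — the Bratteli–Robinson ground-state condition for the dynamics generated by
  `H(t,t',U) - μN` (for `μ = 0` it is implied by `IsGroundState ω (hubbardTTPrimeFermionInteraction t t' U) 1`,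
  `IsGroundState.localStability_ttPrime_zero`; corollaries `IsGroundState.isMeanEnergyMinimiser_ttPrime`,
  `IsGroundState.meanEnergy_eq_energyDensityTT'`). Then, for translation-invariant `ω`:
  - `meanEnergy_sub_mul_density_le_of_groundState`: **`e^{tt'}(ω) - μ ρ(ω) ≤ e^{tt'}(σ) - μ ρ(σ)`
    for every translation-invariant state `σ`** — Bratteli–Kishimoto–Robinson Theorem 2 (`1 ⇒ 2`)
    for the interaction `H - μN`: translation-invariant ground states minimise the mean (free) energy
    `e - μρ`; the surface terms are `O(ℓ)` on the boxes `[0,ℓ)²` (crossing bonds through the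
    `≤ 4ℓ + 4` sites of the collar, each of norm `≤ 4|t|` or `4|t'|`) against `ℓ²` bulk
    (`InfVolFermionStateTTPrimeMeanEnergyBox`);
  - `meanEnergy_eq_energyDensityTT'_of_groundState`: **`e^{tt'}(ω) = energyDensityTT' t t' U ρ(ω)`**
    (`U ≥ 0`, `0 < ρ(ω) < 2`): a translation-invariant ground state has exactly the thermodynamic
    ground-state energy density of its own particle density (with the variational principle
    `IsTranslationInvariant.energyDensityTT'_le_meanEnergy` and its minimisers
    `exists_isTorusLimitOf_squareGroundStatesTT'_meanEnergy_eq`);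
  - `energyDensityTT'_sub_mul_le_of_groundState`: its density minimises `ρ ↦ e(ρ) - μρ` on `(0,2)`
    (`μ` is a chemical potential of `ρ(ω)`);
  - `expect_commutator_sub_smul_totalNumber_eq_zero` / `expect_commutator_localHamiltonian_eq_zero_of_commute`:
    **stationarity** `ω([H^{tt'}_{Λ₁} - μN_{Λ₁}, Γ B]) = 0` for every local `B`, and
    `ω([H^{tt'}_{Λ₁}, Γ B]) = 0` for every particle-number-conserving local `B` (`Λ₁ = thicken Λ 1`) —
    the "equation-of-motion" null rows of the certificate files
    (`HubbardNNNHoppingTorusLimitCorrelatorWindow.lean` etc.) for such states.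

## Source, and what is printed (held text `paper:doi-10-1007-bf01940760`, read pp. 41–48)

O. Bratteli, A. Kishimoto, D. W. Robinson, *Ground states of quantum spin systems*, Commun. Math.
Phys. **64** (1978) 41–48 [BratteliKishimotoRobinson1978]. Theorem 1 (p. 43): for a state `ω` of a
quantum spin system TFAE: (1) `ω(H̃(Λ)) = inf {ω'(H̃(Λ)) : ω' ∈ C_Λ^ω}` for all finite `Λ`, where
`C_Λ^ω` are the states agreeing with `ω` outside `Λ` and `H̃(Λ)` the energy of `Λ` with its
surroundings; (2) `ω` is a ground state (`-i ω(A⋆δ(A)) ≥ 0`). Theorem 2 (p. 47): for a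
`ℤ^ν`-invariant interaction with `‖Φ‖_λ < ∞` and a `ℤ^ν`-invariant state `ω`, TFAE: (1) `ω` is a
ground state; (2) `ω` minimises the mean energy `H_Φ(ω) = lim ω(H_Φ(Λ))/|Λ|`; proof of `1 ⇒ 2`
(pp. 47–48): apply Theorem 1 to `ω' := σ_Λ ⊗ ω_{Λᶜ} ∈ C_Λ^ω` for an invariant `σ`, so that
`ω(H_Φ(Λ)) ≤ σ(H_Φ(Λ)) + ω'(W_Φ(Λ)) - ω(W_Φ(Λ))` with the surface energy `W_Φ(Λ)`,
`‖W_Φ(Λ)‖/|Λ| → 0` (van Hove), and divide by `|Λ|`. The printed proof of Theorem 1 `2 ⇒ 1` goes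
through the normal extension of `ω'` to `π_ω(𝔄)''` (their Lemmas 1–2); HERE the product-state case
needed by Theorem 2 is proved directly: summing the ground-state inequality
`ω((ΓA)⋆ H (ΓA)) ≥ ω((ΓA)⋆(ΓA) H)` over a Kraus family `A_k` of the conditional expectation onto
`σ_Λ` (`Σ A_k⋆ A_k = 1`, `Σ A_k⋆ Z A_k = σ_Λ(Z)1`) gives `ω(H) ≤ (σ_Λ ⊗ ω_{Λᶜ})(H)` up to the
crossing terms. For LATTICE FERMIONS (CAR algebra, even interactions; Bratteli–Robinson II §6.2.7
treats spins, the fermionic statements are Araki–Moriya 2003 §7–§9 for `T > 0`) the same argument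
applies verbatim because even elements of disjoint regions commute (`FermionEmbedLocality.lean`);
the chemical potential enters only through `N_{Λ'} = Γ N_Λ + N_{Λ'∖Λ}` (no crossing terms).
Restated: Bratteli–Robinson II Thm. 6.2.58 [BratteliRobinsonII1997]; Koma–Tasaki, J. Stat. Phys.
76 (1994) App. A [KomaTasaki1994]. The converse `2 ⇒ 1` (Ruelle 1968; completely positive local
perturbations) is NOT proved here.

HONEST SCOPE: this file turns the printed implication "translation-invariant ground state ⇒
stationary and mean-energy minimising" into theorems for the states and interactions of the tree;
it says nothing about the existence or the structure of such ground states.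
-/

noncomputable section

namespace Literature.MathematicalPhysics.QuantumLattice

open Matrix Finset HubbardWave0 Literature.Probability.LatticeModels ThermodynamicLimit
open scoped ComplexOrder

variable {d : ℕ}

namespace InfVolFermionState

/-! ### §1. Local stability summed over a Kraus family -/

section Kraus

variable (ω : InfVolFermionState d) {Λ Λ' : Finset (Site d)} (hΛ : Λ ⊆ Λ')

/-- **Local stability summed over a Kraus family.** If `Re ω((ΓA)⋆(H ΓA - ΓA H)) ≥ 0` for every
`A ∈ 𝔄_Λ` (`Γ` the isotony embedding `𝔄_Λ → 𝔄_{Λ'}`; this is the Bratteli–Robinson ground-state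
inequality `-i ω(A⋆δ(A)) ≥ 0` for `δ = i[H, ·]`), then for every finite family `A_k ∈ 𝔄_Λ` with
`Σ_k A_k⋆ A_k = 1`, `Re ω(H) ≤ Re ω(Σ_k (ΓA_k)⋆ H (ΓA_k))` (sum the inequalities and use
`Σ_k (ΓA_k)⋆ (ΓA_k) = Γ 1 = 1`). Bratteli–Kishimoto–Robinson 1978, proof of Thm. 1 (the computation
behind `1 ⇒ 2` / `2 ⇒ 1`, here with a discrete Kraus family instead of the semigroup `e^{tγ_B}`).
[cite: BratteliKishimotoRobinson1978, Thm. 1 (pp. 43–44)] -/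
theorem re_expect_le_re_expect_sum_conj_of_localStability {H : FermionOp Λ'}
    (hstab : ∀ A : FermionOp Λ,
      0 ≤ (ω.expect Λ' ((fermionEmbed (PolySite.incl hΛ) A)ᴴ *
        (H * fermionEmbed (PolySite.incl hΛ) A - fermionEmbed (PolySite.incl hΛ) A * H))).re)
    {ι : Type*} (s : Finset ι) (A : ι → FermionOp Λ) (hA : ∑ k ∈ s, (A k)ᴴ * A k = 1) :
    (ω.expect Λ' H).re ≤
      (ω.expect Λ' (∑ k ∈ s, (fermionEmbed (PolySite.incl hΛ) (A k))ᴴ * H *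
        fermionEmbed (PolySite.incl hΛ) (A k))).re := by
  have hunit : ∑ k ∈ s, (fermionEmbed (PolySite.incl hΛ) (A k))ᴴ * fermionEmbed (PolySite.incl hΛ) (A k) = 1 := by
    simp_rw [← fermionEmbed_conjTranspose, ← fermionEmbed_mul]
    rw [← map_sum, hA, map_one]
  have hsum : ∑ k ∈ s, (ω.expect Λ' ((fermionEmbed (PolySite.incl hΛ) (A k))ᴴ *
        (H * fermionEmbed (PolySite.incl hΛ) (A k) - fermionEmbed (PolySite.incl hΛ) (A k) * H))).re =
      (ω.expect Λ' (∑ k ∈ s, (fermionEmbed (PolySite.incl hΛ) (A k))ᴴ * H *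
        fermionEmbed (PolySite.incl hΛ) (A k))).re - (ω.expect Λ' H).re := by
    rw [← Complex.re_sum, ← map_sum, ← Complex.sub_re, ← map_sub]
    congr 2
    have hterm : ∀ k ∈ s, (fermionEmbed (PolySite.incl hΛ) (A k))ᴴ *
        (H * fermionEmbed (PolySite.incl hΛ) (A k) - fermionEmbed (PolySite.incl hΛ) (A k) * H) =
        (fermionEmbed (PolySite.incl hΛ) (A k))ᴴ * H * fermionEmbed (PolySite.incl hΛ) (A k) -
          (fermionEmbed (PolySite.incl hΛ) (A k))ᴴ * fermionEmbed (PolySite.incl hΛ) (A k) * H :=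
      fun k _ => by rw [Matrix.mul_sub, Matrix.mul_assoc, Matrix.mul_assoc]
    rw [Finset.sum_congr rfl hterm, Finset.sum_sub_distrib, ← Finset.sum_mul, hunit, Matrix.one_mul]
  have h := Finset.sum_nonneg fun k (_ : k ∈ s) => hstab (A k)
  rw [hsum] at h
  linarith

/-- The conjugation-sum map `Z ↦ Σ_k K_k⋆ Z K_k` fixes every `Z` commuting with all `K_k`, when
`Σ_k K_k⋆ K_k = 1`. [cite: BratteliRobinsonII1997, §5.2.2] -/
theorem sum_conj_eq_self_of_commute {ι : Type*} (s : Finset ι) (K : ι → FermionOp Λ')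
    (hK : ∑ k ∈ s, (K k)ᴴ * K k = 1) {Z : FermionOp Λ'} (hZ : ∀ k ∈ s, Commute Z (K k)) :
    ∑ k ∈ s, (K k)ᴴ * Z * K k = Z := by
  have hterm : ∀ k ∈ s, (K k)ᴴ * Z * K k = (K k)ᴴ * K k * Z := fun k hk => by
    rw [Matrix.mul_assoc, (hZ k hk).eq, ← Matrix.mul_assoc]
  rw [Finset.sum_congr rfl hterm, ← Finset.sum_mul, hK, Matrix.one_mul]

open scoped MatrixOrder Matrix.Norms.L2Operator in
/-- **The conjugation-sum functional is contractive**: if `Σ_k K_k⋆ K_k = 1` in `𝔄_{Λ'}` then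
`‖ω(Σ_k K_k⋆ Z K_k)‖ ≤ ‖Z‖` (L²-operator norm) — `Z ↦ ω(Σ K_k⋆ Z K_k)` is a positive linear
functional with value `1` at `1`, hence of norm `1` (Bratteli–Robinson I Prop. 2.3.11, through the
tree's `PositiveLinearMap.norm_apply_le_of_map_one`). [cite: BratteliRobinsonI1987, Prop. 2.3.11] -/
theorem norm_expect_sum_conj_le {ι : Type*} (s : Finset ι) (K : ι → FermionOp Λ')
    (hK : ∑ k ∈ s, (K k)ᴴ * K k = 1) (Z : FermionOp Λ') :
    ‖ω.expect Λ' (∑ k ∈ s, (K k)ᴴ * Z * K k)‖ ≤ ‖Z‖ := by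
  letI : CStarAlgebra (FermionOp Λ') := {}
  let f : FermionOp Λ' →ₗ[ℂ] ℂ := (ω.expect Λ').comp
    (∑ k ∈ s, (LinearMap.mulRight ℂ (K k)).comp (LinearMap.mulLeft ℂ (K k)ᴴ))
  have hf : ∀ Z, f Z = ω.expect Λ' (∑ k ∈ s, (K k)ᴴ * Z * K k) := fun Z => by
    simp only [f, LinearMap.comp_apply, LinearMap.sum_apply, LinearMap.mulRight_apply,
      LinearMap.mulLeft_apply]
  have hpos : ∀ Z, 0 ≤ Z → 0 ≤ f Z := fun Z hZ => by
    rw [hf, map_sum]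
    refine Finset.sum_nonneg fun k _ => ω.expect_nonneg_of_nonneg Λ' ?_
    have h := star_left_conjugate_nonneg hZ (K k)
    rwa [Matrix.star_eq_conjTranspose] at h
  have h1 : f 1 = 1 := by
    rw [hf]
    simp_rw [Matrix.mul_one]
    rw [hK, ω.expect_one]
  have h := Literature.MathematicalPhysics.QuantumLattice.PositiveLinearMap.norm_apply_le_of_map_one
    (.mk₀ f fun _ hB => hpos _ hB) h1 Z
  rw [← hf]
  exact h

open scoped MatrixOrder Matrix.Norms.L2Operator in
/-- Real-part form of the contractivity: `|Re ω(Σ_k K_k⋆ Z K_k)| ≤ ‖Z‖`. [cite: BratteliRobinsonI1987, Prop. 2.3.11] -/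
theorem abs_re_expect_sum_conj_le {ι : Type*} (s : Finset ι) (K : ι → FermionOp Λ')
    (hK : ∑ k ∈ s, (K k)ᴴ * K k = 1) (Z : FermionOp Λ') :
    |(ω.expect Λ' (∑ k ∈ s, (K k)ᴴ * Z * K k)).re| ≤ ‖Z‖ :=
  (Complex.abs_re_le_norm _).trans (ω.norm_expect_sum_conj_le s K hK Z)

/-- The sum of the diagonal matrix units is the identity: `Σ_s e_{ss}(c) = c · 1`. [folklore] -/
private theorem sum_single_diag {n : Type*} [Fintype n] [DecidableEq n] (c : ℂ) :
    ∑ i : n, Matrix.single i i c = c • (1 : Matrix n n ℂ) := by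
  ext a b
  simp only [Matrix.sum_apply, Matrix.single_apply, Matrix.smul_apply, Matrix.one_apply, smul_eq_mul]
  by_cases hab : a = b
  · subst hab
    simp
  · rw [if_neg hab, mul_zero]
    exact Finset.sum_eq_zero fun i _ => if_neg fun h => hab (h.1.symm.trans h.2)

/-- **Kraus identity of a conjugation by matrix units**: for matrices `W, Z` over a finite index set,
`Σ_{s,t} (W e_{ts})⋆ Z (W e_{ts}) = Tr(W⋆ Z W) · 1`. [folklore] -/
private theorem sum_sum_conj_single (n : Type*) [Fintype n] [DecidableEq n] (W Z : Matrix n n ℂ) :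
    ∑ s : n, ∑ t : n, (W * Matrix.single t s (1 : ℂ))ᴴ * Z * (W * Matrix.single t s 1) =
      ((Wᴴ * Z * W).trace) • (1 : Matrix n n ℂ) := by
  have h1 : ∀ s t : n, (W * Matrix.single t s (1 : ℂ))ᴴ * Z * (W * Matrix.single t s 1) =
      Matrix.single s s ((Wᴴ * Z * W) t t) := by
    intro s t
    rw [Matrix.conjTranspose_mul, Matrix.conjTranspose_single, star_one,
      show Matrix.single s t (1 : ℂ) * Wᴴ * Z * (W * Matrix.single t s 1) =
        Matrix.single s t 1 * (Wᴴ * Z * W) * Matrix.single t s 1 by simp only [Matrix.mul_assoc],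
      Matrix.single_mul_mul_single, one_mul, mul_one]
  simp_rw [h1]
  rw [Finset.sum_comm]
  simp_rw [sum_single_diag, ← Finset.sum_smul]
  rfl

open scoped MatrixOrder in
/-- **The Kraus family of a state's density matrix.** For a state `σ` and a region `Λ` let
`W = √ρ_Λ` (`CFC.sqrt` of the density matrix `σ.rdm Λ`, positive semidefinite of trace one) and
`A_{(s,t)} = W e_{ts}`. Then `Σ_{s,t} A⋆ Z A = σ_Λ(Z) · 1` for every `Z ∈ 𝔄_Λ`: the Kraus form of
the conditional expectation `Z ↦ σ_Λ(Z) 1` onto the state `σ_Λ` (Bratteli–Kishimoto–Robinson's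
comparison state `ω' = σ_Λ ⊗ ω_{Λᶜ}`, Thm. 2 proof, p. 47, in Heisenberg form).
[cite: BratteliKishimotoRobinson1978, Thm. 2 (proof, p. 47)] -/
theorem sum_conj_krausOfState (σ : InfVolFermionState d) (Λ : Finset (Site d)) (Z : FermionOp Λ) :
    ∑ p : Finset (Orb (PolySite Λ)) × Finset (Orb (PolySite Λ)),
        (CFC.sqrt (σ.rdm Λ) * Matrix.single p.2 p.1 (1 : ℂ))ᴴ * Z *
          (CFC.sqrt (σ.rdm Λ) * Matrix.single p.2 p.1 1) = σ.expect Λ Z • (1 : FermionOp Λ) := by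
  set W : FermionOp Λ := CFC.sqrt (σ.rdm Λ) with hW
  have h0 : (0 : FermionOp Λ) ≤ σ.rdm Λ := Matrix.nonneg_iff_posSemidef.2 (σ.rdm_posSemidef Λ)
  have hWW : W * W = σ.rdm Λ := CFC.sqrt_mul_sqrt_self (σ.rdm Λ) h0
  have hWsa : Wᴴ = W := by
    rw [← Matrix.star_eq_conjTranspose]
    exact (CFC.sqrt_nonneg (σ.rdm Λ)).isSelfAdjoint.star_eq
  rw [Fintype.sum_prod_type, sum_sum_conj_single _ W Z, hWsa, Matrix.trace_mul_cycle, hWW,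
    σ.trace_rdm_mul]

open scoped MatrixOrder in
/-- The Kraus family of a state is complete: `Σ_{s,t} A⋆ A = 1`. [cite: BratteliKishimotoRobinson1978, Thm. 2 (proof, p. 47)] -/
theorem sum_conjTranspose_mul_krausOfState (σ : InfVolFermionState d) (Λ : Finset (Site d)) :
    ∑ p : Finset (Orb (PolySite Λ)) × Finset (Orb (PolySite Λ)),
        (CFC.sqrt (σ.rdm Λ) * Matrix.single p.2 p.1 (1 : ℂ))ᴴ *
          (CFC.sqrt (σ.rdm Λ) * Matrix.single p.2 p.1 1) = 1 := by
  have h := σ.sum_conj_krausOfState Λ 1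
  simp_rw [Matrix.mul_one] at h
  rw [h, σ.expect_one, one_smul]

open scoped MatrixOrder Matrix.Norms.L2Operator in
/-- **Bratteli–Kishimoto–Robinson's principle of minimum local energy, product-state case (operator
form).** Let `Λ ⊆ Λ'`, `H ∈ 𝔄_{Λ'}` and suppose `ω` is locally `H`-stable on `Λ`
(`Re ω((ΓA)⋆ [H, ΓA]) ≥ 0` for all `A ∈ 𝔄_Λ`). If `H = Γ(H_in) + H_far + H_×` with `H_far`
commuting with every `Γ A`, `A ∈ 𝔄_Λ`, then for EVERY state `σ`:
`Re ω_Λ(H_in) ≤ Re σ_Λ(H_in) + 2 ‖H_×‖` — `ω` cannot lower its energy inside `Λ` by being replaced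
there by `σ_Λ` (the comparison state `σ_Λ ⊗ ω_{Λᶜ}`), up to the interaction across `∂Λ`.
[cite: BratteliKishimotoRobinson1978, Thm. 1 and Thm. 2 (proof, pp. 47–48)] -/
theorem re_expect_le_of_localStability_of_decomp (σ : InfVolFermionState d) {H : FermionOp Λ'}
    (hstab : ∀ A : FermionOp Λ,
      0 ≤ (ω.expect Λ' ((fermionEmbed (PolySite.incl hΛ) A)ᴴ *
        (H * fermionEmbed (PolySite.incl hΛ) A - fermionEmbed (PolySite.incl hΛ) A * H))).re)
    {Hin : FermionOp Λ} {Hfar Hx : FermionOp Λ'}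
    (hH : H = fermionEmbed (PolySite.incl hΛ) Hin + Hfar + Hx)
    (hfar : ∀ A : FermionOp Λ, Commute Hfar (fermionEmbed (PolySite.incl hΛ) A)) :
    (ω.expect Λ Hin).re ≤ (σ.expect Λ Hin).re + 2 * ‖Hx‖ := by
  -- the Kraus family of `σ_Λ`, embedded by `Γ`
  let Γ : FermionOp Λ →ₐ[ℂ] FermionOp Λ' := fermionEmbed (PolySite.incl hΛ)
  let A : Finset (Orb (PolySite Λ)) × Finset (Orb (PolySite Λ)) → FermionOp Λ := fun p =>
    CFC.sqrt (σ.rdm Λ) * Matrix.single p.2 p.1 (1 : ℂ)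
  have hA1 : ∑ p, (A p)ᴴ * A p = 1 := σ.sum_conjTranspose_mul_krausOfState Λ
  have hK1 : ∑ p, (Γ (A p))ᴴ * Γ (A p) = 1 := by
    change ∑ p, (fermionEmbed (PolySite.incl hΛ) (A p))ᴴ * fermionEmbed (PolySite.incl hΛ) (A p) = 1
    simp_rw [← fermionEmbed_conjTranspose, ← fermionEmbed_mul]
    rw [← map_sum, hA1, map_one]
  -- the summed ground-state inequality
  have hmain := ω.re_expect_le_re_expect_sum_conj_of_localStability hΛ hstab Finset.univ A hA1
  -- the three parts of `Σ K⋆ H K`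
  have hin : ∑ p, (Γ (A p))ᴴ * Γ Hin * Γ (A p) = σ.expect Λ Hin • (1 : FermionOp Λ') := by
    change ∑ p, (fermionEmbed (PolySite.incl hΛ) (A p))ᴴ * fermionEmbed (PolySite.incl hΛ) Hin *
      fermionEmbed (PolySite.incl hΛ) (A p) = _
    simp_rw [← fermionEmbed_conjTranspose, ← fermionEmbed_mul]
    rw [← map_sum, σ.sum_conj_krausOfState Λ Hin, map_smul, map_one]
  have hfar' : ∑ p, (Γ (A p))ᴴ * Hfar * Γ (A p) = Hfar :=
    sum_conj_eq_self_of_commute Finset.univ (fun p => Γ (A p)) hK1 fun p _ => hfar (A p)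
  have hsplit : ∑ p, (Γ (A p))ᴴ * H * Γ (A p) =
      σ.expect Λ Hin • (1 : FermionOp Λ') + Hfar + ∑ p, (Γ (A p))ᴴ * Hx * Γ (A p) := by
    rw [← hin, ← hfar', ← Finset.sum_add_distrib, ← Finset.sum_add_distrib]
    refine Finset.sum_congr rfl fun p _ => ?_
    rw [hH, Matrix.mul_add, Matrix.mul_add, Matrix.add_mul, Matrix.add_mul]
  -- expectations
  have hωH : (ω.expect Λ' H).re = (ω.expect Λ Hin).re + (ω.expect Λ' Hfar).re + (ω.expect Λ' Hx).re := by
    rw [hH, map_add, map_add, ω.compatible hΛ, Complex.add_re, Complex.add_re]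
  have hωK : (ω.expect Λ' (∑ p, (Γ (A p))ᴴ * H * Γ (A p))).re =
      (σ.expect Λ Hin).re + (ω.expect Λ' Hfar).re +
        (ω.expect Λ' (∑ p, (Γ (A p))ᴴ * Hx * Γ (A p))).re := by
    rw [hsplit, map_add, map_add, map_smul, ω.expect_one, Complex.add_re, Complex.add_re, smul_eq_mul,
      mul_one]
  have hx1 : (ω.expect Λ' (∑ p, (Γ (A p))ᴴ * Hx * Γ (A p))).re ≤ ‖Hx‖ :=
    (le_abs_self _).trans (ω.abs_re_expect_sum_conj_le Finset.univ (fun p => Γ (A p)) hK1 Hx)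
  have hx2 : -‖Hx‖ ≤ (ω.expect Λ' Hx).re := (abs_le.1 (ω.abs_re_expect_le Λ' Hx)).1
  rw [hωH, hωK] at hmain
  linarith

/-- **Local stability implies stationarity.** If `Re ω((ΓA)⋆ [H, ΓA]) ≥ 0` for every `A ∈ 𝔄_Λ`,
then `ω([H, ΓB]) = 0` for every `B ∈ 𝔄_Λ`: apply the hypothesis to `A = B + λ·1`, for which
`[H, ΓA] = [H, ΓB]` and `(ΓA)⋆[H,ΓA] = (ΓB)⋆[H,ΓB] + conj(λ) [H,ΓB]`, and let `λ = -s·ω([H,ΓB])`,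
`s → +∞`. Bratteli–Robinson II Prop. 5.3.19 ((1) ⇒ `ω ∘ δ = 0`); Naaijkens 2017 §4.1 (the lemma
following the definition of ground states, arXiv text pp. 36–37). [cite: BratteliRobinsonII1997, Prop. 5.3.19] -/
theorem expect_commutator_eq_zero_of_localStability {H : FermionOp Λ'}
    (hstab : ∀ A : FermionOp Λ,
      0 ≤ (ω.expect Λ' ((fermionEmbed (PolySite.incl hΛ) A)ᴴ *
        (H * fermionEmbed (PolySite.incl hΛ) A - fermionEmbed (PolySite.incl hΛ) A * H))).re)
    (B : FermionOp Λ) :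
    ω.expect Λ' (H * fermionEmbed (PolySite.incl hΛ) B - fermionEmbed (PolySite.incl hΛ) B * H) = 0 := by
  let Γ : FermionOp Λ →ₐ[ℂ] FermionOp Λ' := fermionEmbed (PolySite.incl hΛ)
  set C : FermionOp Λ' := H * Γ B - Γ B * H with hC
  set z : ℂ := ω.expect Λ' C with hz
  set c : ℝ := (ω.expect Λ' ((Γ B)ᴴ * C)).re with hc
  -- the inequality for `A = B + λ 1`
  have key : ∀ lam : ℂ, 0 ≤ c + (star lam * z).re := by
    intro lam
    have h := hstab (B + lam • (1 : FermionOp Λ))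
    have hA : Γ (B + lam • (1 : FermionOp Λ)) = Γ B + lam • (1 : FermionOp Λ') := by
      rw [map_add, map_smul, map_one]
    have hcomm : H * (Γ B + lam • (1 : FermionOp Λ')) - (Γ B + lam • (1 : FermionOp Λ')) * H = C := by
      rw [Matrix.mul_add, Matrix.add_mul, Matrix.mul_smul, Matrix.smul_mul, Matrix.mul_one, Matrix.one_mul, hC]
      abel
    rw [hA, hcomm, Matrix.conjTranspose_add, Matrix.conjTranspose_smul, Matrix.conjTranspose_one,
      Matrix.add_mul, Matrix.smul_mul, Matrix.one_mul, map_add, map_smul, Complex.add_re, smul_eq_mul] at h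
    exact h
  -- conclude `z = 0`
  by_contra hne
  have hzz : 0 < (star z * z).re := by
    rw [Complex.star_def, Complex.mul_re, Complex.conj_re, Complex.conj_im]
    have : z.re ≠ 0 ∨ z.im ≠ 0 := by
      by_contra h
      push Not at h
      exact hne (Complex.ext h.1 h.2)
    rcases this with h | h
    · nlinarith [sq_nonneg z.im, sq_pos_of_ne_zero h]
    · nlinarith [sq_nonneg z.re, sq_pos_of_ne_zero h]
  set r : ℝ := -((c + 1) / (star z * z).re) with hr
  have h := key ((r : ℂ) * z)
  have hre : (star ((r : ℂ) * z) * z).re = -(c + 1) := by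
    rw [star_mul', Complex.star_def, Complex.conj_ofReal, mul_assoc, Complex.re_ofReal_mul,
      ← Complex.star_def, hr, neg_mul, div_mul_cancel₀ _ hzz.ne']
  rw [hre] at h
  linarith

end Kraus

end InfVolFermionState

/-! ### §2. Interactions: the local Hamiltonian near a subregion, ground states -/

namespace FermionInteraction

variable (Ψ : FermionInteraction d) {Λ Λ' : Finset (Site d)}

/-- **The local Hamiltonian of `Λ' ⊇ Λ` split along `Λ`**:
`H_{Λ'} = Γ(H_Λ) + Σ_{X ⊆ Λ', X ∩ Λ = ∅, X ⊄ Λ} Φ X + Σ_{X ⊆ Λ', X ∩ Λ ≠ ∅, X ⊄ Λ} Φ X` — the terms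
inside `Λ` (embedded by isotony), the terms away from `Λ`, and the terms crossing `∂Λ`
(Bratteli–Kishimoto–Robinson's `H(Λ') = H_Φ(Λ) + (H(Λ') - H̃(Λ)) + W_Φ(Λ)`).
[cite: BratteliKishimotoRobinson1978, §3 (H̃_Φ(Λ), W_Φ(Λ), p. 47)] -/
theorem localHamiltonian_eq_fermionEmbed_add_far_add_cross (hΛ : Λ ⊆ Λ') :
    Ψ.localHamiltonian Λ' =
      fermionEmbed (PolySite.incl hΛ) (Ψ.localHamiltonian Λ) +
        (∑ X ∈ Λ'.powerset with (¬ X ⊆ Λ ∧ Disjoint X Λ),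
          (if h : X ⊆ Λ' then fermionEmbed (PolySite.incl h) (Ψ.Φ X) else 0)) +
        (∑ X ∈ Λ'.powerset with (¬ X ⊆ Λ ∧ ¬ Disjoint X Λ),
          (if h : X ⊆ Λ' then fermionEmbed (PolySite.incl h) (Ψ.Φ X) else 0)) := by
  classical
  rw [Ψ.localHamiltonian_eq_sum Λ', ← Finset.sum_filter_add_sum_filter_not Λ'.powerset (fun X => X ⊆ Λ),
    ← Finset.sum_filter_add_sum_filter_not (Λ'.powerset.filter fun X => ¬ X ⊆ Λ) (fun X => Disjoint X Λ),
    Finset.filter_filter, Finset.filter_filter, add_assoc]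
  congr 1
  have hfilter : Λ'.powerset.filter (fun X => X ⊆ Λ) = Λ.powerset := by
    ext X
    simp only [Finset.mem_filter, Finset.mem_powerset]
    exact ⟨fun h => h.2, fun h => ⟨h.trans hΛ, h⟩⟩
  rw [hfilter, Ψ.localHamiltonian_eq_sum Λ, map_sum]
  refine Finset.sum_congr rfl fun X hX => ?_
  rw [Finset.mem_powerset] at hX
  rw [dif_pos (hX.trans hΛ), dif_pos hX, fermionEmbed_fermionEmbed, PolySite.incl_trans]

/-- **Graded locality for an even interaction**: a term `Φ X` with `X ⊆ Λ'` disjoint from `Λ`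
commutes, inside `𝔄_{Λ'}`, with every observable of `Λ` (even elements of disjoint regions commute).
[cite: BratteliRobinsonII1997, §5.2.2 (even elements of disjoint regions commute)] -/
theorem commute_fermionEmbed_apply_of_disjoint (hΨ : Ψ.IsEven) {X : Finset (Site d)} (hX : X ⊆ Λ')
    (hΛ : Λ ⊆ Λ') (hd : Disjoint X Λ) (A : FermionOp Λ) :
    Commute (fermionEmbed (PolySite.incl hX) (Ψ.Φ X)) (fermionEmbed (PolySite.incl hΛ) A) := by
  refine commute_fermionEmbed_of_mem_carEvenSubalgebra (PolySite.incl hΛ) A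
    (fermionEmbed_mem_carEvenSubalgebra (PolySite.incl hX)
      (JordanWigner.mem_carEvenSubalgebra_univ_of_parityAut_eq (hΨ X))) ?_
  refine disjoint_orbs (Finset.disjoint_left.2 ?_)
  intro p hpX hpΛ
  rw [Finset.mem_map] at hpX hpΛ
  obtain ⟨a, -, ha⟩ := hpX
  obtain ⟨b, -, hb⟩ := hpΛ
  have hab : a.1 = b.1 := by
    rw [← PolySite.coe_incl hX a, ← PolySite.coe_incl hΛ b, ha, hb]
  exact Finset.disjoint_left.1 hd (mem_lexSites.1 a.2) (hab ▸ mem_lexSites.1 b.2)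

/-- The terms away from `Λ` commute with every observable of `Λ` (for an even interaction).
[cite: BratteliRobinsonII1997, §5.2.2] -/
theorem commute_farSum_fermionEmbed (hΨ : Ψ.IsEven) (hΛ : Λ ⊆ Λ') (A : FermionOp Λ) :
    Commute (∑ X ∈ Λ'.powerset with (¬ X ⊆ Λ ∧ Disjoint X Λ),
        (if h : X ⊆ Λ' then fermionEmbed (PolySite.incl h) (Ψ.Φ X) else 0))
      (fermionEmbed (PolySite.incl hΛ) A) := by
  refine Commute.sum_left _ _ _ fun X hX => ?_
  rw [Finset.mem_filter, Finset.mem_powerset] at hX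
  rw [dif_pos hX.1]
  exact Ψ.commute_fermionEmbed_apply_of_disjoint hΨ hX.1 hΛ hX.2.2 A

end FermionInteraction

namespace InfVolFermionState

variable {ω : InfVolFermionState d} {Ψ : FermionInteraction d} {R : ℝ}

/-- **A ground state is locally `H_{Λ_R}`-stable** (real form of the defining inequality): for
every region `Λ` and `A ∈ 𝔄_Λ`, `Re ω((ΓA)⋆ (H_{Λ_R} ΓA - ΓA H_{Λ_R})) ≥ 0`, `Λ_R = thicken Λ R`,
`Γ` the isotony embedding (`-i ω(A⋆δ(A)) ≥ 0` with `δ(A) = i[H_{Λ_R}, ΓA]`).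
[cite: BratteliKishimotoRobinson1978, §1 (definition of τ-ground state)] -/
theorem IsGroundState.re_expect_conj_commutator_nonneg (hgs : ω.IsGroundState Ψ R) (Λ : Finset (Site d))
    (A : FermionOp Λ) :
    0 ≤ (ω.expect (thicken Λ R) ((fermionEmbed (PolySite.incl (subset_thicken Λ R)) A)ᴴ *
      (Ψ.localHamiltonian (thicken Λ R) * fermionEmbed (PolySite.incl (subset_thicken Λ R)) A -
        fermionEmbed (PolySite.incl (subset_thicken Λ R)) A * Ψ.localHamiltonian (thicken Λ R)))).re := by
  have h := hgs Λ A
  rw [FermionInteraction.derivation, Matrix.mul_smul, map_smul, smul_eq_mul, ← mul_assoc,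
    show -Complex.I * Complex.I = 1 by rw [neg_mul, Complex.I_mul_I, neg_neg], one_mul] at h
  exact (Complex.nonneg_iff.1 h).1

open scoped Matrix.Norms.L2Operator in
/-- **Bratteli–Kishimoto–Robinson's principle of minimum local energy (Theorem 1, `2 ⇒ 1`), product
case, for an even finite-range interaction of a lattice fermion system.** If `ω` is a ground state
of `Ψ` (`IsGroundState ω Ψ R`) then for every finite region `Λ` and EVERY state `σ`,
`Re ω(H_Λ) ≤ Re σ(H_Λ) + 2 ‖W‖`, where `H_Λ = Σ_{X ⊆ Λ} Φ X` and
`W = Σ_{X ⊆ thicken Λ R, X ⊄ Λ, X ∩ Λ ≠ ∅} Φ X` is the interaction across `∂Λ`: the energy of `ω` in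
`Λ` is not lowered by replacing `ω` there by any other state (printed: `ω(H̃(Λ)) = inf_{ω' ∈ C_Λ^ω}
ω'(H̃(Λ))`, here for `ω' = σ_Λ ⊗ ω_{Λᶜ}` and with the surface energy estimated by its norm).
[cite: BratteliKishimotoRobinson1978, Thm. 1 (p. 43) and Thm. 2 (proof, pp. 47–48)] -/
theorem IsGroundState.re_expect_localHamiltonian_le (hgs : ω.IsGroundState Ψ R) (hΨ : Ψ.IsEven)
    (σ : InfVolFermionState d) (Λ : Finset (Site d)) :
    (ω.expect Λ (Ψ.localHamiltonian Λ)).re ≤ (σ.expect Λ (Ψ.localHamiltonian Λ)).re +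
      2 * ‖∑ X ∈ (thicken Λ R).powerset with (¬ X ⊆ Λ ∧ ¬ Disjoint X Λ),
        (if h : X ⊆ thicken Λ R then fermionEmbed (PolySite.incl h) (Ψ.Φ X) else 0)‖ :=
  ω.re_expect_le_of_localStability_of_decomp (subset_thicken Λ R) σ
    (hgs.re_expect_conj_commutator_nonneg Λ)
    (Ψ.localHamiltonian_eq_fermionEmbed_add_far_add_cross (subset_thicken Λ R))
    (Ψ.commute_farSum_fermionEmbed hΨ (subset_thicken Λ R))

/-- **Ground states are stationary**: `ω([H_{Λ_R}, ΓB]) = 0` for every local `B ∈ 𝔄_Λ`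
(`ω ∘ δ = 0` on the local algebra). Bratteli–Robinson II Prop. 5.3.19; Bratteli–Kishimoto–Robinson
1978, §1 ("It follows that `ω` is `τ`-invariant"). [cite: BratteliRobinsonII1997, Prop. 5.3.19] -/
theorem IsGroundState.expect_commutator_localHamiltonian_eq_zero (hgs : ω.IsGroundState Ψ R)
    (Λ : Finset (Site d)) (B : FermionOp Λ) :
    ω.expect (thicken Λ R) (Ψ.localHamiltonian (thicken Λ R) * fermionEmbed (PolySite.incl (subset_thicken Λ R)) B -
      fermionEmbed (PolySite.incl (subset_thicken Λ R)) B * Ψ.localHamiltonian (thicken Λ R)) = 0 :=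
  ω.expect_commutator_eq_zero_of_localStability (subset_thicken Λ R) (hgs.re_expect_conj_commutator_nonneg Λ) B

end InfVolFermionState

/-! ### §3. The `t–t'` Hubbard model on `ℤ²` with a chemical potential

Throughout, `H^{tt'}_Λ = (hubbardTTPrimeFermionInteraction t t' U).localHamiltonian Λ`, `N_Λ = totalNumber`,
`Λ₁ = thicken Λ 1`, and the GROUND-STATE HYPOTHESIS `hgs` (a section variable) is local
`(H^{tt'}_{Λ₁} - μ N_{Λ₁})`-stability of `ω` on every finite `Λ ⊆ ℤ²`. -/

section NumberDecomposition

variable {Λ Λ' : Finset (Site d)}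

/-- **The particle number of `Λ' ⊇ Λ` splits along `Λ`**: `N_{Λ'} = Γ(N_Λ) + Σ_{x ∈ Λ'∖Λ, σ} n_{xσ}`.
[cite: BratteliRobinsonII1997, §6.2.1 (local structure of lattice systems)] -/
theorem totalNumber_eq_fermionEmbed_add_sum (hΛ : Λ ⊆ Λ') :
    (totalNumber : FermionOp Λ') = fermionEmbed (PolySite.incl hΛ) (totalNumber : FermionOp Λ) +
      ∑ p ∈ (Finset.univ : Finset (PolySite Λ')) with ofLex p.1 ∉ Λ, ∑ σ : Fin 2, numberOp p σ := by
  classical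
  have hmap : (Finset.univ : Finset (PolySite Λ')).filter (fun p => ofLex p.1 ∈ Λ) =
      (Finset.univ : Finset (PolySite Λ)).map (PolySite.incl hΛ) := by
    ext p
    simp only [Finset.mem_filter, Finset.mem_univ, true_and, Finset.mem_map]
    constructor
    · intro hp
      exact ⟨⟨p.1, mem_lexSites.2 hp⟩, Subtype.ext rfl⟩
    · rintro ⟨q, rfl⟩
      exact mem_lexSites.1 q.2
  rw [totalNumber, ← Finset.sum_filter_add_sum_filter_not Finset.univ (fun p : PolySite Λ' => ofLex p.1 ∈ Λ),
    hmap, Finset.sum_map, totalNumber, map_sum]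
  congr 1
  refine Finset.sum_congr rfl fun q _ => ?_
  rw [map_sum]
  exact Finset.sum_congr rfl fun σ _ => (fermionEmbed_numberOp _ q σ).symm

/-- The particle number outside `Λ` commutes with every observable of `Λ` (number operators are
even). [cite: BratteliRobinsonII1997, §5.2.2] -/
theorem commute_outsideNumber_fermionEmbed (hΛ : Λ ⊆ Λ') (A : FermionOp Λ) :
    Commute (∑ p ∈ (Finset.univ : Finset (PolySite Λ')) with ofLex p.1 ∉ Λ, ∑ σ : Fin 2, numberOp p σ)
      (fermionEmbed (PolySite.incl hΛ) A) := by
  refine Commute.sum_left _ _ _ fun p hp => Commute.sum_left _ _ _ fun σ _ => ?_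
  rw [Finset.mem_filter] at hp
  refine commute_fermionEmbed_of_mem_carEvenSubalgebra (PolySite.incl hΛ) A
    (numberOp_mem_carEvenSubalgebra (orb_mem_orbs.2 (Finset.mem_singleton_self p))) ?_
  refine disjoint_orbs (Finset.disjoint_singleton_left.2 fun h => hp.2 ?_)
  rw [Finset.mem_map] at h
  obtain ⟨q, -, rfl⟩ := h
  exact mem_lexSites.1 q.2

end NumberDecomposition

/-! #### The interaction across the boundary of a box -/

section Crossing

variable (t t' U : ℝ)

open scoped Matrix.Norms.L2Operator in
/-- An embedded nearest-neighbour bond term of the `t–t'` interaction has norm `≤ 4|t|`.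
[cite: BratteliRobinsonI1987, Prop. 2.3.11] -/
theorem norm_dite_fermionEmbed_pair_unitVec_le (Λ' : Finset (Site 2)) (y : Site 2) (i : Fin 2) :
    ‖(if h : ({y, y + unitVec i} : Finset (Site 2)) ⊆ Λ' then
        fermionEmbed (PolySite.incl h) ((hubbardTTPrimeFermionInteraction t t' U).Φ {y, y + unitVec i}) else 0)‖ ≤
      4 * |t| := by
  split_ifs with h
  · rw [hubbardTTPrimeFermionInteraction_apply_pair_unitVec, hubbardFermionInteraction_apply_pair, fermionEmbed_smul,
      fermionEmbed_sum]
    simp only [fermionEmbed_add, fermionEmbed_mul, fermionEmbed_conjTranspose, fermionEmbed_incl_cAt]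
    exact norm_hoppingTerm_le t (fun σ => orb (PolySite.pt y (h (mem_insert_self _ _))) σ)
      (fun σ => orb (PolySite.pt (y + unitVec i) (h (mem_insert_of_mem (mem_singleton_self _)))) σ)
  · rw [norm_zero]; positivity

open scoped Matrix.Norms.L2Operator in
/-- An embedded diagonal bond term of the `t–t'` interaction has norm `≤ 4|t'|`.
[cite: BratteliRobinsonI1987, Prop. 2.3.11] -/
theorem norm_dite_fermionEmbed_pair_diagVec_le (Λ' : Finset (Site 2)) (y : Site 2) (s : Fin 2) :
    ‖(if h : ({y, y + diagVec s} : Finset (Site 2)) ⊆ Λ' then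
        fermionEmbed (PolySite.incl h) ((hubbardTTPrimeFermionInteraction t t' U).Φ {y, y + diagVec s}) else 0)‖ ≤
      4 * |t'| := by
  split_ifs with h
  · rw [hubbardTTPrimeFermionInteraction_apply_pair_diagVec, diagHoppingFermionInteraction_apply_pair, fermionEmbed_smul,
      fermionEmbed_sum]
    simp only [fermionEmbed_add, fermionEmbed_mul, fermionEmbed_conjTranspose, fermionEmbed_incl_cAt]
    exact norm_hoppingTerm_le t' (fun σ => orb (PolySite.pt y (h (mem_insert_self _ _))) σ)
      (fun σ => orb (PolySite.pt (y + diagVec s) (h (mem_insert_of_mem (mem_singleton_self _)))) σ)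
  · rw [norm_zero]; positivity

open scoped Matrix.Norms.L2Operator in
/-- Every embedded bond `{x, x + v}` through `x` in one of the eight bond directions
`v ∈ {±e_i, ±(e₁ ± e₂)}` has norm `≤ 4(|t| + |t'|)`. [cite: BratteliRobinsonI1987, Prop. 2.3.11] -/
theorem norm_dite_fermionEmbed_pair_le_of_mem_directions (Λ' : Finset (Site 2)) (x : Site 2) {v : Site 2}
    (hv : v ∈ ((Finset.univ : Finset (Fin 2)).image unitVec ∪ (Finset.univ : Finset (Fin 2)).image fun i => -unitVec i) ∪
      ((Finset.univ : Finset (Fin 2)).image diagVec ∪ (Finset.univ : Finset (Fin 2)).image fun s => -diagVec s)) :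
    ‖(if h : ({x, x + v} : Finset (Site 2)) ⊆ Λ' then
        fermionEmbed (PolySite.incl h) ((hubbardTTPrimeFermionInteraction t t' U).Φ {x, x + v}) else 0)‖ ≤
      4 * (|t| + |t'|) := by
  have ht : 4 * |t| ≤ 4 * (|t| + |t'|) := by linarith [abs_nonneg t']
  have ht' : 4 * |t'| ≤ 4 * (|t| + |t'|) := by linarith [abs_nonneg t]
  simp only [Finset.mem_union, Finset.mem_image, Finset.mem_univ, true_and] at hv
  rcases hv with (⟨i, rfl⟩ | ⟨i, rfl⟩) | (⟨s, rfl⟩ | ⟨s, rfl⟩)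
  · exact (norm_dite_fermionEmbed_pair_unitVec_le t t' U Λ' x i).trans ht
  · have hset : ({x, x + -unitVec i} : Finset (Site 2)) = {x - unitVec i, x - unitVec i + unitVec i} := by
      rw [sub_add_cancel, ← sub_eq_add_neg, Finset.pair_comm]
    rw [hset]
    exact (norm_dite_fermionEmbed_pair_unitVec_le t t' U Λ' (x - unitVec i) i).trans ht
  · exact (norm_dite_fermionEmbed_pair_diagVec_le t t' U Λ' x s).trans ht'
  · have hset : ({x, x + -diagVec s} : Finset (Site 2)) = {x - diagVec s, x - diagVec s + diagVec s} := by
      rw [sub_add_cancel, ← sub_eq_add_neg, Finset.pair_comm]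
    rw [hset]
    exact (norm_dite_fermionEmbed_pair_diagVec_le t t' U Λ' (x - diagVec s) s).trans ht'

/-- A nonzero term of the `t–t'` interaction through a site `x` (other than the on-site term) is one
of the eight bonds `{x, x + v}`, `v ∈ {±e_i, ±(e₁ ± e₂)}`. [cite: XuEtAl2024, eq. (1)] -/
theorem mem_image_pair_of_apply_ne_zero {x : Site 2} {X : Finset (Site 2)} (hxX : x ∈ X) (hX : X ≠ {x})
    (hΦ : (hubbardTTPrimeFermionInteraction t t' U).Φ X ≠ 0) :
    X ∈ (((Finset.univ : Finset (Fin 2)).image unitVec ∪ (Finset.univ : Finset (Fin 2)).image fun i => -unitVec i) ∪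
      ((Finset.univ : Finset (Fin 2)).image diagVec ∪ (Finset.univ : Finset (Fin 2)).image fun s => -diagVec s)).image
        fun v => ({x, x + v} : Finset (Site 2)) := by
  by_contra hXD
  refine hΦ (hubbardTTPrimeFermionInteraction_apply_eq_zero t t' U (fun z hz => ?_) (fun z i hz => hXD ?_)
    (fun z s hz => hXD ?_))
  · subst hz
    rw [Finset.mem_singleton] at hxX
    subst hxX
    exact hX rfl
  · subst hz
    rw [Finset.mem_insert, Finset.mem_singleton] at hxX
    rcases hxX with rfl | rfl
    · exact Finset.mem_image.2 ⟨unitVec i, by simp, rfl⟩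
    · refine Finset.mem_image.2 ⟨-unitVec i, by simp, ?_⟩
      rw [add_neg_cancel_right, Finset.pair_comm]
  · subst hz
    rw [Finset.mem_insert, Finset.mem_singleton] at hxX
    rcases hxX with rfl | rfl
    · exact Finset.mem_image.2 ⟨diagVec s, by simp, rfl⟩
    · refine Finset.mem_image.2 ⟨-diagVec s, by simp, ?_⟩
      rw [add_neg_cancel_right, Finset.pair_comm]

open scoped Matrix.Norms.L2Operator in
/-- **The interaction through one site is bounded**: for every region `Λ'` and site `x`, the embedded
terms `Φ X`, `x ∈ X ⊆ Λ'`, `X ≠ {x}`, of the `t–t'` interaction have total norm `≤ 32(|t| + |t'|)`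
(at most eight bonds through `x`, each of norm `≤ 4|t|` or `4|t'|`).
[cite: BratteliKishimotoRobinson1978, §3 (‖Φ‖ = Σ_{X∋0} ‖Φ(X)‖ < ∞)] -/
theorem sum_norm_dite_fermionEmbed_through_le (Λ' : Finset (Site 2)) (x : Site 2) :
    ∑ X ∈ Λ'.powerset with (x ∈ X ∧ X ≠ {x}),
        ‖(if h : X ⊆ Λ' then fermionEmbed (PolySite.incl h) ((hubbardTTPrimeFermionInteraction t t' U).Φ X) else 0)‖ ≤
      32 * (|t| + |t'|) := by
  classical
  set D : Finset (Site 2) :=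
    ((Finset.univ : Finset (Fin 2)).image unitVec ∪ (Finset.univ : Finset (Fin 2)).image fun i => -unitVec i) ∪
      ((Finset.univ : Finset (Fin 2)).image diagVec ∪ (Finset.univ : Finset (Fin 2)).image fun s => -diagVec s) with hD
  have hDcard : D.card ≤ 8 := by
    have h2 : ∀ f : Fin 2 → Site 2, ((Finset.univ : Finset (Fin 2)).image f).card ≤ 2 := fun f =>
      Finset.card_image_le.trans (by simp)
    calc D.card ≤ ((Finset.univ : Finset (Fin 2)).image unitVec ∪
            (Finset.univ : Finset (Fin 2)).image fun i => -unitVec i).card +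
          ((Finset.univ : Finset (Fin 2)).image diagVec ∪
            (Finset.univ : Finset (Fin 2)).image fun s => -diagVec s).card := Finset.card_union_le _ _
      _ ≤ (2 + 2) + (2 + 2) := add_le_add ((Finset.card_union_le _ _).trans (add_le_add (h2 _) (h2 _)))
          ((Finset.card_union_le _ _).trans (add_le_add (h2 _) (h2 _)))
      _ = 8 := by norm_num
  rw [← Finset.sum_filter_ne_zero]
  set S := (Λ'.powerset.filter fun X => x ∈ X ∧ X ≠ {x}).filter fun X =>
    ‖(if h : X ⊆ Λ' then fermionEmbed (PolySite.incl h) ((hubbardTTPrimeFermionInteraction t t' U).Φ X) else 0)‖ ≠ 0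
    with hS
  have hsub : S ⊆ D.image fun v => ({x, x + v} : Finset (Site 2)) := by
    intro X hX
    rw [hS, Finset.mem_filter, Finset.mem_filter, Finset.mem_powerset] at hX
    obtain ⟨⟨hXΛ, hxX, hXx⟩, hne⟩ := hX
    refine mem_image_pair_of_apply_ne_zero t t' U hxX hXx fun h0 => hne ?_
    rw [dif_pos hXΛ, h0, map_zero, norm_zero]
  have hcardS : (S.card : ℝ) ≤ 8 := by
    exact_mod_cast (Finset.card_le_card hsub).trans (Finset.card_image_le.trans hDcard)
  have hterm : ∀ X ∈ S,
      ‖(if h : X ⊆ Λ' then fermionEmbed (PolySite.incl h) ((hubbardTTPrimeFermionInteraction t t' U).Φ X) else 0)‖ ≤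
        4 * (|t| + |t'|) := by
    intro X hX
    obtain ⟨v, hv, rfl⟩ := Finset.mem_image.1 (hsub hX)
    exact norm_dite_fermionEmbed_pair_le_of_mem_directions t t' U Λ' x hv
  calc _ ≤ S.card • (4 * (|t| + |t'|)) := Finset.sum_le_card_nsmul _ _ _ hterm
    _ = (S.card : ℝ) * (4 * (|t| + |t'|)) := nsmul_eq_mul _ _
    _ ≤ 8 * (4 * (|t| + |t'|)) := mul_le_mul_of_nonneg_right hcardS (by positivity)
    _ = 32 * (|t| + |t'|) := by ring

/-- **The crossing terms are covered by the sites of the collar**: for `Λ ⊆ Λ'`, the total norm of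
the embedded terms `Φ X`, `X ⊆ Λ'` meeting both `Λ` and `Λ'∖Λ`, is at most the sum over `x ∈ Λ'∖Λ` of
the norms of the terms through `x` (every crossing `X` contains such an `x`, and then `X ≠ {x}`).
[cite: BratteliKishimotoRobinson1978, §3 (surface energy W_Φ(Λ))] -/
theorem sum_norm_cross_le_sum_sdiff {E : Type*} [SeminormedAddCommGroup E] (Λ Λ' : Finset (Site d))
    (g : Finset (Site d) → E) :
    ∑ X ∈ Λ'.powerset with (¬ X ⊆ Λ ∧ ¬ Disjoint X Λ), ‖g X‖ ≤
      ∑ x ∈ Λ' \ Λ, ∑ X ∈ Λ'.powerset with (x ∈ X ∧ X ≠ {x}), ‖g X‖ := by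
  classical
  -- a choice of a collar site in every crossing region
  let c : Finset (Site d) → Site d := fun X => if h : (X \ Λ).Nonempty then h.choose else 0
  have hc : ∀ X : Finset (Site d), ¬ X ⊆ Λ → c X ∈ X \ Λ := fun X hX => by
    have hne : (X \ Λ).Nonempty := Finset.sdiff_nonempty.2 hX
    simp only [c, dif_pos hne]
    exact hne.choose_spec
  have hmaps : ∀ X ∈ Λ'.powerset.filter (fun X => ¬ X ⊆ Λ ∧ ¬ Disjoint X Λ), c X ∈ Λ' \ Λ := by
    intro X hX
    rw [Finset.mem_filter, Finset.mem_powerset] at hX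
    exact Finset.sdiff_subset_sdiff hX.1 le_rfl (hc X hX.2.1)
  rw [← Finset.sum_fiberwise_of_maps_to hmaps]
  refine Finset.sum_le_sum fun y hy => Finset.sum_le_sum_of_subset_of_nonneg (fun X hX => ?_)
    fun _ _ _ => norm_nonneg _
  rw [Finset.mem_filter, Finset.mem_filter, Finset.mem_powerset] at hX
  obtain ⟨⟨hXΛ', hXΛ, hXd⟩, hcy⟩ := hX
  rw [Finset.mem_filter, Finset.mem_powerset]
  have hy' : y ∈ X \ Λ := hcy ▸ hc X hXΛ
  rw [Finset.mem_sdiff] at hy'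
  refine ⟨hXΛ', hy'.1, fun h => hXd ?_⟩
  rw [h]
  exact Finset.disjoint_singleton_left.2 hy'.2

/-- **The `1`-collar of the box `[0,ℓ)²` has at most `(ℓ+2)²` sites.** [folklore] -/
private theorem card_thicken_halfOpenBox_one_le (ℓ : ℕ) : (thicken (halfOpenBox 2 ℓ) 1).card ≤ (ℓ + 2) ^ 2 := by
  classical
  let w : Site 2 := fun _ => -1
  have hsub : thicken (halfOpenBox 2 ℓ) 1 ⊆ (halfOpenBox 2 (ℓ + 2)).image fun z => z + w := by
    intro y hy
    rw [thicken, Finset.mem_biUnion] at hy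
    obtain ⟨x, hx, hy⟩ := hy
    rw [Finset.mem_image] at hy
    obtain ⟨v, hv, rfl⟩ := hy
    rw [mem_box, Nat.floor_one, Nat.cast_one] at hv
    rw [mem_halfOpenBox] at hx
    refine Finset.mem_image.2 ⟨x + v - w, ?_, sub_add_cancel _ _⟩
    rw [mem_halfOpenBox]
    intro i
    have h1 := hx i
    have h2 := hv i
    simp only [Pi.add_apply, Pi.sub_apply, w]
    push_cast
    omega
  calc (thicken (halfOpenBox 2 ℓ) 1).card ≤ ((halfOpenBox 2 (ℓ + 2)).image fun z => z + w).card := Finset.card_le_card hsub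
    _ ≤ (halfOpenBox 2 (ℓ + 2)).card := Finset.card_image_le
    _ = (ℓ + 2) ^ 2 := card_halfOpenBox 2 (ℓ + 2)

/-- The collar `thicken [0,ℓ)² 1 ∖ [0,ℓ)²` has at most `4ℓ + 4` sites. [folklore] -/
private theorem card_thicken_sdiff_halfOpenBox_le (ℓ : ℕ) :
    (thicken (halfOpenBox 2 ℓ) 1 \ halfOpenBox 2 ℓ).card ≤ 4 * ℓ + 4 := by
  rw [Finset.card_sdiff_of_subset (subset_thicken _ _), card_halfOpenBox]
  have h := card_thicken_halfOpenBox_one_le ℓ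
  have : (ℓ + 2) ^ 2 = ℓ ^ 2 + (4 * ℓ + 4) := by ring
  omega

open scoped Matrix.Norms.L2Operator in
/-- **The interaction across the boundary of the box `[0,ℓ)²` is `O(ℓ)`**: the crossing terms of the
`t–t'` interaction between `[0,ℓ)²` and its `1`-collar have total norm `≤ 32(|t| + |t'|)(4ℓ + 4)`
(Bratteli–Kishimoto–Robinson: `‖W_Φ(Λ)‖/|Λ| → 0` as `Λ → ∞` in the sense of van Hove).
[cite: BratteliKishimotoRobinson1978, Thm. 2 (proof, p. 48)] -/
theorem norm_crossSum_halfOpenBox_le (ℓ : ℕ) :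
    ‖∑ X ∈ (thicken (halfOpenBox 2 ℓ) 1).powerset with (¬ X ⊆ halfOpenBox 2 ℓ ∧ ¬ Disjoint X (halfOpenBox 2 ℓ)),
        (if h : X ⊆ thicken (halfOpenBox 2 ℓ) 1 then
          fermionEmbed (PolySite.incl h) ((hubbardTTPrimeFermionInteraction t t' U).Φ X) else 0)‖ ≤
      32 * (|t| + |t'|) * (4 * ℓ + 4) := by
  refine (norm_sum_le _ _).trans ((sum_norm_cross_le_sum_sdiff _ _ _).trans ?_)
  refine (Finset.sum_le_sum fun x _ => sum_norm_dite_fermionEmbed_through_le t t' U _ x).trans ?_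
  rw [Finset.sum_const, nsmul_eq_mul, mul_comm]
  refine mul_le_mul_of_nonneg_left ?_ (by positivity)
  exact_mod_cast card_thicken_sdiff_halfOpenBox_le ℓ

end Crossing

/-! #### Translation-invariant ground states of `H(t,t',U) - μN` minimise `e - μρ` -/

namespace InfVolFermionState

section TTPrimeMu

variable {ω : InfVolFermionState 2} {t t' U μ : ℝ}
variable (hgs : ∀ (Λ : Finset (Site 2)) (A : FermionOp Λ),
    0 ≤ (ω.expect (thicken Λ 1)
      ((fermionEmbed (PolySite.incl (subset_thicken Λ 1)) A)ᴴ *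
        (((hubbardTTPrimeFermionInteraction t t' U).localHamiltonian (thicken Λ 1) -
              (μ : ℂ) • (totalNumber : FermionOp (thicken Λ 1))) *
            fermionEmbed (PolySite.incl (subset_thicken Λ 1)) A -
          fermionEmbed (PolySite.incl (subset_thicken Λ 1)) A *
            ((hubbardTTPrimeFermionInteraction t t' U).localHamiltonian (thicken Λ 1) -
              (μ : ℂ) • (totalNumber : FermionOp (thicken Λ 1)))))).re)

open scoped Matrix.Norms.L2Operator in
include hgs in
/-- **Principle of minimum local energy for `H(t,t',U) - μN`.** If `ω` is locally
`(H^{tt'}_{Λ₁} - μN_{Λ₁})`-stable on every region (`Λ₁ = thicken Λ 1`; the Bratteli–Robinson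
ground-state condition for the dynamics of `H - μN`), then for every finite `Λ ⊆ ℤ²` and every state
`σ`: `Re ω(H^{tt'}_Λ) - μ Re ω(N_Λ) ≤ Re σ(H^{tt'}_Λ) - μ Re σ(N_Λ) + 2 ‖W_Λ‖`, `W_Λ` the crossing
terms between `Λ` and its collar. [cite: BratteliKishimotoRobinson1978, Thm. 1 and Thm. 2 (proof, pp. 47–48)] -/
theorem re_expect_localHamiltonian_sub_mul_totalNumber_le_of_groundState (σ : InfVolFermionState 2)
    (Λ : Finset (Site 2)) :
    (ω.expect Λ ((hubbardTTPrimeFermionInteraction t t' U).localHamiltonian Λ)).re -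
        μ * (ω.expect Λ (totalNumber : FermionOp Λ)).re ≤
      (σ.expect Λ ((hubbardTTPrimeFermionInteraction t t' U).localHamiltonian Λ)).re -
          μ * (σ.expect Λ (totalNumber : FermionOp Λ)).re +
        2 * ‖∑ X ∈ (thicken Λ 1).powerset with (¬ X ⊆ Λ ∧ ¬ Disjoint X Λ),
          (if h : X ⊆ thicken Λ 1 then
            fermionEmbed (PolySite.incl h) ((hubbardTTPrimeFermionInteraction t t' U).Φ X) else 0)‖ := by
  have hre : ∀ ν : InfVolFermionState 2,
      (ν.expect Λ ((hubbardTTPrimeFermionInteraction t t' U).localHamiltonian Λ -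
          (μ : ℂ) • (totalNumber : FermionOp Λ))).re =
        (ν.expect Λ ((hubbardTTPrimeFermionInteraction t t' U).localHamiltonian Λ)).re -
          μ * (ν.expect Λ (totalNumber : FermionOp Λ)).re := fun ν => by
    rw [map_sub, map_smul, Complex.sub_re, smul_eq_mul, Complex.re_ofReal_mul]
  have h := ω.re_expect_le_of_localStability_of_decomp (subset_thicken Λ 1) σ (hgs Λ)
    (Hin := (hubbardTTPrimeFermionInteraction t t' U).localHamiltonian Λ - (μ : ℂ) • (totalNumber : FermionOp Λ))
    (Hfar := (∑ X ∈ (thicken Λ 1).powerset with (¬ X ⊆ Λ ∧ Disjoint X Λ),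
        (if h : X ⊆ thicken Λ 1 then
          fermionEmbed (PolySite.incl h) ((hubbardTTPrimeFermionInteraction t t' U).Φ X) else 0)) -
      (μ : ℂ) • ∑ p ∈ (Finset.univ : Finset (PolySite (thicken Λ 1))) with ofLex p.1 ∉ Λ,
        ∑ σ : Fin 2, numberOp p σ)
    (Hx := ∑ X ∈ (thicken Λ 1).powerset with (¬ X ⊆ Λ ∧ ¬ Disjoint X Λ),
        (if h : X ⊆ thicken Λ 1 then
          fermionEmbed (PolySite.incl h) ((hubbardTTPrimeFermionInteraction t t' U).Φ X) else 0))
    ?_ ?_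
  · rw [hre, hre] at h
    exact h
  · rw [(hubbardTTPrimeFermionInteraction t t' U).localHamiltonian_eq_fermionEmbed_add_far_add_cross
      (subset_thicken Λ 1), totalNumber_eq_fermionEmbed_add_sum (subset_thicken Λ 1), map_sub, map_smul,
      smul_add]
    abel
  · intro A
    exact ((hubbardTTPrimeFermionInteraction t t' U).commute_farSum_fermionEmbed
      (hubbardTTPrimeFermionInteraction_isEven t t' U) (subset_thicken Λ 1) A).sub_left
        ((commute_outsideNumber_fermionEmbed (subset_thicken Λ 1) A).smul_left _)

include hgs in
/-- **Translation-invariant ground states of `H(t,t',U) - μN` minimise the mean free energy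
`e^{tt'} - μρ` (Bratteli–Kishimoto–Robinson 1978, Theorem 2, `1 ⇒ 2`, for the interaction
`H - μN` of the `t–t'` Hubbard model on `ℤ²`).** If `ω` is translation invariant and locally
`(H^{tt'}_{Λ₁} - μN_{Λ₁})`-stable on every region, then for every translation-invariant state `σ`:
`e^{tt'}(ω) - μ ρ(ω) ≤ e^{tt'}(σ) - μ ρ(σ)`, where `e^{tt'} = meanEnergy (hubbardTTPrimeFermionInteraction t t' U) 1`
and `ρ = density`. (On the boxes `[0,ℓ)²`: the principle of minimum local energy, the box
bookkeeping `|ℓ² e^{tt'} - Re ω(H_{[0,ℓ)²})| ≤ (8|t| + 16|t'|)ℓ`, `Re ω(N_{[0,ℓ)²}) = ℓ² ρ`, the `O(ℓ)`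
crossing bound, and `ℓ → ∞`.) [cite: BratteliKishimotoRobinson1978, Thm. 2 (p. 47)] -/
theorem meanEnergy_sub_mul_density_le_of_groundState (hω : ω.IsTranslationInvariant)
    {σ : InfVolFermionState 2} (hσ : σ.IsTranslationInvariant) :
    ω.meanEnergy (hubbardTTPrimeFermionInteraction t t' U) 1 - μ * ω.density ≤
      σ.meanEnergy (hubbardTTPrimeFermionInteraction t t' U) 1 - μ * σ.density := by
  set C : ℝ := 2 * (8 * |t| + 16 * |t'|) + 2 * (32 * (|t| + |t'|)) * 8 with hC
  -- the estimate on the box of side `ℓ ≥ 1`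
  have hbox : ∀ ℓ : ℕ, 1 ≤ ℓ →
      (ℓ : ℝ) ^ 2 * (ω.meanEnergy (hubbardTTPrimeFermionInteraction t t' U) 1 - μ * ω.density) ≤
        (ℓ : ℝ) ^ 2 * (σ.meanEnergy (hubbardTTPrimeFermionInteraction t t' U) 1 - μ * σ.density) + C * ℓ := by
    intro ℓ hℓ
    have hℓ1 : (1 : ℝ) ≤ ℓ := by exact_mod_cast hℓ
    have h1 := hω.abs_sq_mul_meanEnergyTTPrime_sub_re_expect_localHamiltonian_le t' t U ℓ
    have h2 := hσ.abs_sq_mul_meanEnergyTTPrime_sub_re_expect_localHamiltonian_le t' t U ℓ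
    have hNω := hω.re_expect_totalNumber (halfOpenBox 2 ℓ)
    have hNσ := hσ.re_expect_totalNumber (halfOpenBox 2 ℓ)
    rw [card_halfOpenBox, Nat.cast_pow] at hNω hNσ
    have hloc := re_expect_localHamiltonian_sub_mul_totalNumber_le_of_groundState hgs σ (halfOpenBox 2 ℓ)
    have hcross := norm_crossSum_halfOpenBox_le t t' U ℓ
    have hcross' : 32 * (|t| + |t'|) * (4 * (ℓ : ℝ) + 4) ≤ 32 * (|t| + |t'|) * 8 * ℓ := by
      rw [mul_assoc (32 * (|t| + |t'|)) 8]
      exact mul_le_mul_of_nonneg_left (by linarith) (by positivity)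
    rw [abs_le] at h1 h2
    rw [hNω, hNσ] at hloc
    rw [hC]
    nlinarith [h1.1, h1.2, h2.1, h2.2, hloc, hcross, hcross']
  -- `ℓ → ∞`
  refine le_of_forall_pos_lt_add fun ε hε => ?_
  obtain ⟨n, hn⟩ := exists_nat_gt (C / ε)
  have h := hbox (n + 1) (Nat.le_add_left 1 n)
  push_cast at h
  have hLpos : (0 : ℝ) < (n : ℝ) + 1 := by positivity
  have hL : C / ε < (n : ℝ) + 1 := hn.trans (lt_add_one _)
  rw [div_lt_iff₀ hε] at hL
  by_contra hcon
  push Not at hcon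
  have h3 := mul_le_mul_of_nonneg_left hcon (sq_nonneg ((n : ℝ) + 1))
  have h4 : C * ((n : ℝ) + 1) < ε * ((n : ℝ) + 1) * ((n : ℝ) + 1) :=
    by nlinarith [mul_lt_mul_of_pos_right hL hLpos]
  nlinarith [h3, h4, h]

include hgs in
/-- **A translation-invariant ground state of `H(t,t',U) - μN` has the least `t–t'` mean energy
among the translation-invariant states of its own density.** [cite: BratteliKishimotoRobinson1978, Thm. 2 (p. 47)] -/
theorem meanEnergy_le_of_groundState_of_density_eq (hω : ω.IsTranslationInvariant)
    {σ : InfVolFermionState 2} (hσ : σ.IsTranslationInvariant) (hρ : σ.density = ω.density) :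
    ω.meanEnergy (hubbardTTPrimeFermionInteraction t t' U) 1 ≤
      σ.meanEnergy (hubbardTTPrimeFermionInteraction t t' U) 1 := by
  have h := meanEnergy_sub_mul_density_le_of_groundState hgs hω hσ
  rw [hρ] at h
  linarith

include hgs in
/-- **The mean energy of a translation-invariant ground state IS the thermodynamic ground-state energy
density of its particle density**: for `U ≥ 0` and `0 < ρ(ω) < 2`, if `ω` is translation invariant
and locally `(H^{tt'}_{Λ₁} - μN_{Λ₁})`-stable on every region, then
`e^{tt'}(ω) = energyDensityTT' t t' U ρ(ω)` — the implication "translation-invariant ground state ⇒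
minimal mean energy `ẽ₀(ρ)`" of Bratteli–Robinson II Thm. 6.2.58 / Koma–Tasaki App. A, for the
`t–t'` Hubbard model, with `ẽ₀(ρ) = energyDensityTT' t t' U ρ` by the variational principle
`isLeast_meanEnergy_energyDensityTT'`. [cite: BratteliRobinsonII1997, Thm. 6.2.58] -/
theorem meanEnergy_eq_energyDensityTT'_of_groundState (hω : ω.IsTranslationInvariant) (hU : 0 ≤ U)
    (hρ0 : 0 < ω.density) (hρ2 : ω.density < 2) :
    ω.meanEnergy (hubbardTTPrimeFermionInteraction t t' U) 1 = energyDensityTT' t t' U ω.density := by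
  refine le_antisymm ?_ (hω.energyDensityTT'_le_meanEnergy t t' hU hρ0 hρ2)
  obtain ⟨ψ, Ls, σ, -, -, hti, -, -, -, hdens, -, he⟩ :=
    exists_isTorusLimitOf_squareGroundStatesTT'_meanEnergy_eq t t' hU hρ0.le hρ2
  rw [← he]
  exact meanEnergy_le_of_groundState_of_density_eq hgs hω hti hdens

include hgs in
/-- **`μ` is a chemical potential of the ground state's density**: under the same hypotheses,
`e(ρ(ω)) - μ ρ(ω) ≤ e(ρ) - μρ` for every `ρ ∈ (0,2)`, `e = energyDensityTT' t t' U` (the density of a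
translation-invariant ground state of `H - μN` minimises `ρ ↦ e(ρ) - μρ`).
[cite: KomaTasaki1994, App. A (Props. A.1–A.3)] -/
theorem energyDensityTT'_sub_mul_le_of_groundState (hω : ω.IsTranslationInvariant) (hU : 0 ≤ U)
    (hρ0 : 0 < ω.density) (hρ2 : ω.density < 2) {ρ : ℝ} (h0 : 0 < ρ) (h2 : ρ < 2) :
    energyDensityTT' t t' U ω.density - μ * ω.density ≤ energyDensityTT' t t' U ρ - μ * ρ := by
  obtain ⟨ψ, Ls, σ, -, -, hti, -, -, -, hdens, -, he⟩ :=
    exists_isTorusLimitOf_squareGroundStatesTT'_meanEnergy_eq t t' hU h0.le h2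
  rw [← meanEnergy_eq_energyDensityTT'_of_groundState hgs hω hU hρ0 hρ2, ← he, ← hdens]
  exact meanEnergy_sub_mul_density_le_of_groundState hgs hω hti

include hgs in
/-- **Stationarity**: `ω([H^{tt'}_{Λ₁} - μN_{Λ₁}, ΓB]) = 0` for every region `Λ` and every
`B ∈ 𝔄_Λ` (`Λ₁ = thicken Λ 1`, `Γ` the isotony embedding).
[cite: BratteliRobinsonII1997, Prop. 5.3.19] -/
theorem expect_commutator_sub_smul_totalNumber_eq_zero (Λ : Finset (Site 2)) (B : FermionOp Λ) :
    ω.expect (thicken Λ 1)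
      (((hubbardTTPrimeFermionInteraction t t' U).localHamiltonian (thicken Λ 1) -
            (μ : ℂ) • (totalNumber : FermionOp (thicken Λ 1))) *
          fermionEmbed (PolySite.incl (subset_thicken Λ 1)) B -
        fermionEmbed (PolySite.incl (subset_thicken Λ 1)) B *
          ((hubbardTTPrimeFermionInteraction t t' U).localHamiltonian (thicken Λ 1) -
            (μ : ℂ) • (totalNumber : FermionOp (thicken Λ 1)))) = 0 :=
  ω.expect_commutator_eq_zero_of_localStability (subset_thicken Λ 1) (hgs Λ) B

include hgs in
/-- **The equation-of-motion rows**: for a particle-number-conserving local observable `B ∈ 𝔄_Λ`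
(`[B, N_Λ] = 0`), `ω([H^{tt'}_{Λ₁}, ΓB]) = 0` — the "eom" null constraints of the ground-state
certificates (`HubbardNNNHoppingTorusLimitCorrelatorWindow.lean`), here for every state satisfying
the ground-state condition of `H - μN`. [cite: BratteliRobinsonII1997, Prop. 5.3.19] -/
theorem expect_commutator_localHamiltonian_eq_zero_of_commute (Λ : Finset (Site 2)) {B : FermionOp Λ}
    (hB : Commute B (totalNumber : FermionOp Λ)) :
    ω.expect (thicken Λ 1)
      ((hubbardTTPrimeFermionInteraction t t' U).localHamiltonian (thicken Λ 1) *
          fermionEmbed (PolySite.incl (subset_thicken Λ 1)) B -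
        fermionEmbed (PolySite.incl (subset_thicken Λ 1)) B *
          (hubbardTTPrimeFermionInteraction t t' U).localHamiltonian (thicken Λ 1)) = 0 := by
  have h := expect_commutator_sub_smul_totalNumber_eq_zero hgs Λ B
  have hN : Commute (totalNumber : FermionOp (thicken Λ 1)) (fermionEmbed (PolySite.incl (subset_thicken Λ 1)) B) := by
    rw [totalNumber_eq_fermionEmbed_add_sum (subset_thicken Λ 1)]
    exact (hB.symm.map (fermionEmbed (PolySite.incl (subset_thicken Λ 1)))).add_left
      (commute_outsideNumber_fermionEmbed (subset_thicken Λ 1) B)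
  have hcomm : ((hubbardTTPrimeFermionInteraction t t' U).localHamiltonian (thicken Λ 1) -
            (μ : ℂ) • (totalNumber : FermionOp (thicken Λ 1))) *
          fermionEmbed (PolySite.incl (subset_thicken Λ 1)) B -
        fermionEmbed (PolySite.incl (subset_thicken Λ 1)) B *
          ((hubbardTTPrimeFermionInteraction t t' U).localHamiltonian (thicken Λ 1) -
            (μ : ℂ) • (totalNumber : FermionOp (thicken Λ 1))) =
      (hubbardTTPrimeFermionInteraction t t' U).localHamiltonian (thicken Λ 1) *
          fermionEmbed (PolySite.incl (subset_thicken Λ 1)) B -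
        fermionEmbed (PolySite.incl (subset_thicken Λ 1)) B *
          (hubbardTTPrimeFermionInteraction t t' U).localHamiltonian (thicken Λ 1) := by
    rw [Matrix.sub_mul, Matrix.mul_sub, Matrix.smul_mul, Matrix.mul_smul, hN.eq]
    abel
  rw [hcomm] at h
  exact h

end TTPrimeMu

/-! #### The case `μ = 0`: ground states of the `t–t'` interaction itself -/

section TTPrime

variable {ω : InfVolFermionState 2} {t t' U : ℝ}

/-- A ground state of the `t–t'` interaction (`IsGroundState ω (hubbardTTPrimeFermionInteraction t t' U) 1`)
satisfies the ground-state hypothesis of this file with `μ = 0`.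
[cite: BratteliKishimotoRobinson1978, §1 (definition of τ-ground state)] -/
theorem IsGroundState.localStability_ttPrime_zero
    (hgs0 : ω.IsGroundState (hubbardTTPrimeFermionInteraction t t' U) 1) (Λ : Finset (Site 2)) (A : FermionOp Λ) :
    0 ≤ (ω.expect (thicken Λ 1)
      ((fermionEmbed (PolySite.incl (subset_thicken Λ 1)) A)ᴴ *
        (((hubbardTTPrimeFermionInteraction t t' U).localHamiltonian (thicken Λ 1) -
              ((0 : ℝ) : ℂ) • (totalNumber : FermionOp (thicken Λ 1))) *
            fermionEmbed (PolySite.incl (subset_thicken Λ 1)) A -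
          fermionEmbed (PolySite.incl (subset_thicken Λ 1)) A *
            ((hubbardTTPrimeFermionInteraction t t' U).localHamiltonian (thicken Λ 1) -
              ((0 : ℝ) : ℂ) • (totalNumber : FermionOp (thicken Λ 1)))))).re := by
  rw [Complex.ofReal_zero, zero_smul, sub_zero]
  exact hgs0.re_expect_conj_commutator_nonneg Λ A

/-- **Bratteli–Kishimoto–Robinson Theorem 2 (`1 ⇒ 2`) for the `t–t'` Hubbard interaction**: a
translation-invariant ground state `ω` (`IsGroundState ω (hubbardTTPrimeFermionInteraction t t' U) 1`)
satisfies `e^{tt'}(ω) ≤ e^{tt'}(σ)` for every translation-invariant `σ`, i.e. it is a mean-energy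
minimiser (`IsMeanEnergyMinimiser`). [cite: BratteliKishimotoRobinson1978, Thm. 2 (p. 47)] -/
theorem IsGroundState.isMeanEnergyMinimiser_ttPrime
    (hgs0 : ω.IsGroundState (hubbardTTPrimeFermionInteraction t t' U) 1) (hω : ω.IsTranslationInvariant) :
    ω.IsMeanEnergyMinimiser (hubbardTTPrimeFermionInteraction t t' U) 1 := by
  refine ⟨hω, fun σ hσ => ?_⟩
  have h := meanEnergy_sub_mul_density_le_of_groundState (μ := 0)
    (fun Λ A => hgs0.localStability_ttPrime_zero Λ A) hω hσ
  simp only [zero_mul, sub_zero] at h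
  exact h

/-- For `U ≥ 0` and `0 < ρ(ω) < 2`, a translation-invariant ground state of the `t–t'` interaction has
mean energy `energyDensityTT' t t' U ρ(ω)`. [cite: BratteliRobinsonII1997, Thm. 6.2.58] -/
theorem IsGroundState.meanEnergy_eq_energyDensityTT'
    (hgs0 : ω.IsGroundState (hubbardTTPrimeFermionInteraction t t' U) 1) (hω : ω.IsTranslationInvariant)
    (hU : 0 ≤ U) (hρ0 : 0 < ω.density) (hρ2 : ω.density < 2) :
    ω.meanEnergy (hubbardTTPrimeFermionInteraction t t' U) 1 = energyDensityTT' t t' U ω.density :=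
  meanEnergy_eq_energyDensityTT'_of_groundState (μ := 0) (fun Λ A => hgs0.localStability_ttPrime_zero Λ A)
    hω hU hρ0 hρ2

end TTPrime

end InfVolFermionState

end Literature.MathematicalPhysics.QuantumLattice

end
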